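import Summits.AtomisticToContinuum.HydrodynamicLimit.Theses.RelayRaceLocality
import Summits.AtomisticToContinuum.HydrodynamicLimit.Theorems.RelayRaceLocalityNearConstantShortTimeHLWindowTransfer
import Summits.AtomisticToContinuum.HydrodynamicLimit.Theorems.RelayRaceLocalityNearConstantShortTimeHLEntropyToLLN
import HarnessLib

/-!
# Crux `NearConstantShortTimeHL` (stmt-AtomisticToContinuum-12502), line `Sketch`: the kernel-checked reduction

Support file of the line lead (continuation seat prover-line-stmt-AtomisticToContinuum-12502-c1-0, 2026-08-16) for the
crux `Summit.AtomisticToContinuum.HydrodynamicLimit.Theses.RelayRaceLocality.NearConstantShortTimeHL` (the near-constant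
short-time hydrodynamic limit for general diameter/number families). It records, sorry-free and in the tree, what the
line `Sketch` (card `fejer-isometry-window-transfer`) has reduced the crux to after its two provable stubs landed
(`stub_windowTransfer`, p99138; `stub_entropyToLLN`, p100911):

* `nearConstantShortTimeHL_of_ledger` — the crux follows from the kinetic large-deviation input in the quadratic-growth
  class `KineticFluxLdDecayQuad` (the re-typed shared crux stmt-AtomisticToContinuum-10967, an OPEN named conjecture of the
  programme) together with the near-constant entropy ledger `ExpWindowDecayQ → NearConstantRelEntropy` (the line's residue,
  registered stub `stub_nearConstantLedger`);
* `nearConstantShortTimeHL_of_window_ledger` — the same with the window decay `ExpWindowDecayQ` itself as the kinetic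
  hypothesis (one rung up the landed ladder `KineticFluxLdDecayQuad → ExpWindowDecayQ`).

(Dropping the kinetic side altogether, the crux from the Yau-form statement `NearConstantRelEntropy` alone is the landed
`stub_entropyToLLN` of `Theorems/RelayRaceLocalityNearConstantShortTimeHLEntropyToLLN.lean`; it is not restated here.)

Both are CONDITIONAL results (hypotheses are named open statements); nothing here is claimed unconditionally. The
point of the file is bookkeeping for the planners: over the tree, crux 12502 under line `Sketch` is EXACTLY the conjunction
"`KineticFluxLdDecayQuad` ∧ (`ExpWindowDecayQ → NearConstantRelEntropy`)", and the second conjunct is where the line stops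
(see `Cruxes/NearConstantShortTimeHL/Lines/SketchDead.md`). References: H.-T. Yau, Lett. Math. Phys. 22 (1991) §2;
S. Olla, S. R. S. Varadhan, H.-T. Yau, Comm. Math. Phys. 155 (1993) §3; H. Spohn, Large Scale Dynamics of Interacting
Particles (1991), Part I §7.1.
-/

noncomputable section

namespace Summit.AtomisticToContinuum.HydrodynamicLimit.Theorems.NearConstantShortTimeHL

open Summit.AtomisticToContinuum.HydrodynamicLimit.Theses.RelayRaceLocality (NearConstantShortTimeHL)
open Summit.AtomisticToContinuum.HydrodynamicLimit.Theorems.KineticWindowGronwallKineticClass (KineticFluxLdDecayQuad)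

/-- **The crux modulo the line's two open stubs.** If the kinetic large-deviation input holds in the quadratic-growth
class (`KineticFluxLdDecayQuad`, OPEN conjecture, re-typed stmt-10967) and the near-constant entropy ledger
`ExpWindowDecayQ → NearConstantRelEntropy` holds, then `NearConstantShortTimeHL`: compose the landed window transfer
(`stub_windowTransfer`: one good kinetic window gives all longer windows under the invariant homogeneous Gibbs law) with
the ledger and the landed entropy-to-LLN step (`stub_entropyToLLN`: `o(n_N)` relative entropy against an exponentially
concentrating reference gives the law of large numbers at time `t`). CONDITIONAL. [cite: Yau1991, §2] -/
theorem nearConstantShortTimeHL_of_ledger :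
    KineticFluxLdDecayQuad → (ExpWindowDecayQ → NearConstantRelEntropy) → NearConstantShortTimeHL :=
  fun hK hL => stub_entropyToLLN (hL (stub_windowTransfer hK))

/-- **The crux modulo window decay and the ledger.** If the exponential window decay in the quadratic-growth class
holds for all long kinetic windows under the homogeneous Gibbs law (`ExpWindowDecayQ`, OPEN) and the near-constant
entropy ledger `ExpWindowDecayQ → NearConstantRelEntropy` holds, then `NearConstantShortTimeHL`. CONDITIONAL.
[cite: OllaVaradhanYau1993, §3] -/
theorem nearConstantShortTimeHL_of_window_ledger :
    ExpWindowDecayQ → (ExpWindowDecayQ → NearConstantRelEntropy) → NearConstantShortTimeHL :=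
  fun hW hL => stub_entropyToLLN (hL hW)

end Summit.AtomisticToContinuum.HydrodynamicLimit.Theorems.NearConstantShortTimeHL

end
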